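import Summits.CriticalPhenomena.PercolationContinuityZ3.Theorems.Transplant.Slab111SK4Plan
import HarnessLib

/-!
# Small thickness `(111)`-films, radius FOUR, VII: from kernel certificates to the NODE CLAUSE of `ShapedLinkage 4` for one case

builds on p205010 (kernel theorem, internal audit signed; external expert review pending) — NOT used in this file.  Lane `prim-bschramm`, seat
`prim-bschramm-p2` (gen 38; class C1b; memo `HOME/bschramm/P2-LATTICES.md` §136); helper file (`--supports stmt-CriticalPhenomena-4575 --as helper`).
* §1 `RowOK` / **`CaseOK C`** (every needed bit of every certified pair has a covering plan) and the soundness of the certificate readers of «Slab111SK4Defs»: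
  `rdPlans_sound`, `checkRow_sound`, **`checkEs_sound`** (a kernel-checked chunk `C.checkEs es certs = true` gives `RowOK` on the chunk), `caseOK_of_chunks`;
* §2 the admissibility masks `allowedM` / `forcedM` of the instance's cleared mask (`Ctx4.wOK`);
* §3 **`linkage_of_caseOK`**: `CaseOK C` + `wOK` give the clause of `HexShadow.ShapedLinkage 4` («HexShadowVRouteData») for every block whose parameters
  the case dominates, with the cleared set `Wset4 C z` («Slab111SK4Path»): terminals pass the filter («Slab111SK4Terms»), cover bits are swap pairs («Slab111SK4Plan»).
[cite: DuminilCopinSidoraviciusTassion2016, §2.3 (proof of Fact 2: the three disjoint paths in B_R(z))]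
-/

noncomputable section

namespace Summit.CriticalPhenomena.PercolationContinuityZ3.Theorems.Transplant

open Literature.Probability.Percolation Literature.Probability.LatticeModels SimpleGraph
open scoped Classical

namespace Slab111.SK4

open Slab111.SK (ne_of_mem_tail ne_getLast_of_mem_dropLast mem_ne_ends eq_dropLast_append_of_getLast? eq_cons_tail_of_head? of_testBit_cond_not of_testBit_match_option bitOf sdiff maskBelow maskOfList endsOK orFold rd rdMask testBit_bitOf testBit_sdiff testBit_maskBelow of_testBit_maskBelow testBit_maskBelow_of testBit_foldl_or testBit_orFold testBit_maskOfList testBit_maskOfList_eq_false testBit_of_sdiff_eq_zero testBit_of_sdiff_beq testBit_false_of_land_eq_zero endsOK_sound sh_lev_of_adj triNorm_le_succ_of_adj)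

variable {C : Ctx4} {z : Site 2}

/-! ## §1 Case coverage and the certificate readers -/

/-- **Row coverage**: every needed bit of every partner of `e₁` has a covering plan. [folklore] -/
def RowOK (C : Ctx4) (e1 : ℕ) : Prop :=
  ∀ e2 ∈ C.esList, e2 ≠ e1 → ∀ w, (C.needMask e1 e2).testBit w = true → ∃ c1 y b c2 av, (C.coverOf e1 e2 c1 y b c2 av).testBit w = true

/-- **Case coverage**: all rows. [folklore] -/
def CaseOK (C : Ctx4) : Prop := ∀ e1 ∈ C.esList, RowOK C e1

/-- Soundness of the plan reader: an accumulated bit comes from the accumulator or from one of the plans read. [folklore] -/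
theorem rdPlans_sound (C : Ctx4) (e1 e2 w : ℕ) : ∀ (cnt n acc : ℕ), (C.rdPlans e1 e2 cnt n acc).1.testBit w = true →
    acc.testBit w = true ∨ ∃ c1 y b c2 av, (C.coverOf e1 e2 c1 y b c2 av).testBit w = true
  | 0, _, _, h => Or.inl h
  | cnt + 1, n, acc, h => by
    simp only [Ctx4.rdPlans] at h
    rcases rdPlans_sound C e1 e2 w cnt _ _ h with h | h
    · revert h
      cases (C.coverOf e1 e2 (rd n).1 (rd (rd n).2).1 (rd (rd (rd n).2).2).1 (rd (rd (rd (rd n).2).2).2).1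
          (rdMask (rd (rd (rd (rd (rd n).2).2).2).2).1 (rd (rd (rd (rd (rd n).2).2).2).2).2 0).1 == 0) with
      | true => intro h; exact Or.inl h
      | false =>
        intro h
        simp only [cond_false, Nat.testBit_lor, Bool.or_eq_true] at h
        rcases h with h | h
        · exact Or.inl h
        · exact Or.inr ⟨_, _, _, _, _, h⟩
    · exact Or.inr h

/-- **Soundness of the row checker.** [folklore] -/
theorem checkRow_sound (C : Ctx4) (e1 : ℕ) : ∀ (es : List ℕ) (n : ℕ), C.checkRow e1 es n = true →
    ∀ e2 ∈ es, e2 ≠ e1 → ∀ w, (C.needMask e1 e2).testBit w = true → ∃ c1 y b c2 av, (C.coverOf e1 e2 c1 y b c2 av).testBit w = true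
  | [], _, _ => fun _ h => nomatch h
  | e2 :: rest, n, h => by
    intro x hx hxe w hw
    simp only [Ctx4.checkRow] at h
    by_cases he : e2 = e1
    · have hb : (e2 == e1) = true := by simp [he]
      rw [hb, cond_true] at h
      rcases List.mem_cons.1 hx with rfl | hx
      · exact absurd he hxe
      · exact checkRow_sound C e1 rest n h x hx hxe w hw
    · have hb : (e2 == e1) = false := by simp [he]
      rw [hb, cond_false] at h
      by_cases hn : C.needMask e1 e2 = 0
      · have hb2 : (C.needMask e1 e2 == 0) = true := by simp [hn]
        rw [hb2, cond_true] at h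
        rcases List.mem_cons.1 hx with rfl | hx
        · rw [hn, Nat.zero_testBit] at hw; exact absurd hw Bool.false_ne_true
        · exact checkRow_sound C e1 rest n h x hx hxe w hw
      · have hb2 : (C.needMask e1 e2 == 0) = false := by simp [hn]
        rw [hb2, cond_false] at h
        try dsimp only at h
        generalize hr : C.rdPlans e1 e2 (rd n).1 (rd n).2 0 = r at h
        cases hs : (sdiff (C.needMask e1 e2) r.1 == 0) with
        | false => rw [hs] at h; exact absurd h Bool.false_ne_true
        | true =>
          rw [hs, cond_true] at h
          rcases List.mem_cons.1 hx with rfl | hx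
          · have hcov := testBit_of_sdiff_beq hs hw
            rw [← hr] at hcov
            rcases rdPlans_sound C e1 _ w _ _ _ hcov with h0 | hp
            · rw [Nat.zero_testBit] at h0; exact absurd h0 Bool.false_ne_true
            · exact hp
          · exact checkRow_sound C e1 rest _ h x hx hxe w hw

/-- **SOUNDNESS OF A KERNEL-CHECKED CHUNK**: `C.checkEs es certs = true` gives row coverage for every terminal of the chunk. [folklore] -/
theorem checkEs_sound (C : Ctx4) : ∀ (es certs : List ℕ), C.checkEs es certs = true → ∀ e1 ∈ es, RowOK C e1
  | [], _, _ => fun _ h => nomatch h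
  | e1 :: rest, certs, h => by
    intro x hx
    cases certs with
    | nil => simp [Ctx4.checkEs] at h
    | cons n certs' =>
      simp only [Ctx4.checkEs] at h
      cases hrow : C.checkRow e1 C.esList n with
      | false => rw [hrow] at h; exact absurd h Bool.false_ne_true
      | true =>
        rw [hrow, cond_true] at h
        rcases List.mem_cons.1 hx with rfl | hx
        · exact fun e2 he2 hne w hw => checkRow_sound C x C.esList n hrow e2 he2 hne w hw
        · exact checkEs_sound C rest certs' h x hx

/-- **Case coverage from chunks covering the terminal list.** [folklore] -/
theorem caseOK_of_chunks (C : Ctx4) (chunks : List (List ℕ)) (h : ∀ ch ∈ chunks, ∀ e1 ∈ ch, RowOK C e1)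
    (hcov : (C.esList.all fun e => chunks.any fun ch => ch.elem e) = true) : CaseOK C := by
  intro e1 he1
  rw [List.all_eq_true] at hcov
  have := hcov e1 he1
  rw [List.any_eq_true] at this
  obtain ⟨ch, hch, hel⟩ := this
  exact h ch hch e1 (List.elem_iff.1 hel)

/-! ## §2 Admissibility masks of the cleared mask -/

/-- Allowed bits: over `hexBall z 4 ∩ {a ≤ t₁} ∩ {a + b ≤ s₁}`. [folklore] -/
def Ctx4.allowedB (C : Ctx4) (t1 s1 i : ℕ) : Bool :=
  C.validB i && decide (2 ≤ dA4 i) && decide (dA4 i ≤ 10) && decide (2 ≤ dB4 i) && decide (dB4 i ≤ 10) && decide (8 ≤ dA4 i + dB4 i) &&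
    decide (dA4 i + dB4 i ≤ 16) && decide (dA4 i ≤ t1 + 6) && decide (dA4 i + dB4 i ≤ s1 + 12)

/-- Forced bits: over `hexBall z 1 ∩ {a ≤ t₁} ∩ {a + b ≤ s₁}`. [folklore] -/
def Ctx4.forcedB (C : Ctx4) (t1 s1 i : ℕ) : Bool :=
  C.validB i && decide (5 ≤ dA4 i) && decide (dA4 i ≤ 7) && decide (5 ≤ dB4 i) && decide (dB4 i ≤ 7) && decide (11 ≤ dA4 i + dB4 i) &&
    decide (dA4 i + dB4 i ≤ 13) && decide (dA4 i ≤ t1 + 6) && decide (dA4 i + dB4 i ≤ s1 + 12)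

/-- The allowed mask. [folklore] -/
def Ctx4.allowedM (C : Ctx4) (t1 s1 : ℕ) : ℕ := maskBelow (C.allowedB t1 s1) 1440
/-- The forced mask. [folklore] -/
def Ctx4.forcedM (C : Ctx4) (t1 s1 : ℕ) : ℕ := maskBelow (C.forcedB t1 s1) 1440

/-! ## §3 The node clause for a covered case -/

/-- **THE NODE CLAUSE OF `ShapedLinkage 4` FOR ONE COVERED CASE.**  For a case context `C` with `CaseOK C` and an admissible cleared mask
(`C.wOK (allowedM t₁ s₁) (forcedM t₁ s₁)`, `t₁ ≤ t_D`, `s₁ ≤ s_D`, each either exact or `≥ 1`), every block centre `z` of class `C.c0` and all node parameters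
the case dominates (`C.tR = min t_R 4`, `C.sR = min s_R 4`, window bounds at least `t_D`, `s_R` or unconstrained): the cleared set `Wset4 C z` lies in
`\overline{blkR 4 z t_D s_D}`, contains every vertex over `hexBall z 1 ∩ blkR 4 z t_D s_D`, and every certified terminal triple has a swap pair of routings.
[cite: DuminilCopinSidoraviciusTassion2016, §2.3 (proof of Fact 2: the three disjoint paths in B_R(z))] -/
theorem linkage_of_caseOK (hcase : CaseOK C) (hk : C.k ≤ 9) (hz : ClassHyp4 C z) {tR tD sR sD : ℕ}
    (htR : C.tR = min tR 4) (hsR : C.sR = min sR 4) (hwT : tD ≤ C.wT ∨ 5 ≤ C.wT) (hwS : sR ≤ C.wS ∨ 5 ≤ C.wS)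
    {t1 s1 : ℕ} (ht1 : t1 ≤ tD) (hs1 : s1 ≤ sD) (ht1' : t1 = tD ∨ 1 ≤ t1) (hs1' : s1 = sD ∨ 1 ≤ s1)
    (hW : C.wOK (C.allowedM t1 s1) (C.forcedM t1 s1) = true) :
    (∀ x ∈ Wset4 C z, (hexShadow C.k).sh x ∈ blkR 4 z tD sD) ∧
      (∀ x, (hexShadow C.k).sh x ∈ hexBall z 1 → (hexShadow C.k).sh x ∈ blkR 4 z tD sD → x ∈ Wset4 C z) ∧
        ∀ (E₁ E₂ w' : slab111 C.k), (hexShadow C.k).Terminals 4 z tR tD sR (Wset4 C z) E₁ E₂ w' →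
          ∃ r₁ r₂ : VRouteData (film C.k) (Wset4 C z ∩ (hexShadow C.k).lift (blkR 4 z tR sR)) (Wset4 C z) E₁ E₂ w', r₁.y = r₂.b ∧ r₁.b = r₂.y := by
  have hW' := hW
  simp only [Ctx4.wOK, Bool.and_eq_true] at hW'
  obtain ⟨hWall, hWfor⟩ := hW'
  have hWv : ∀ i, C.W.testBit i = true → C.validB i = true := by
    intro i hi
    have := of_testBit_maskBelow (testBit_of_sdiff_beq hWall hi)
    simp only [Ctx4.allowedB, Bool.and_eq_true] at this
    exact this.2.1.1.1.1.1.1.1.1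
  refine ⟨fun x hx => ?_, fun x h1 hD => ?_, fun E₁ E₂ w' hT => ?_⟩
  · obtain ⟨i, hv, hWi, rfl⟩ := exists_idx_of_mem_Wset hx
    have := of_testBit_maskBelow (testBit_of_sdiff_beq hWall hWi)
    simp only [Ctx4.allowedB, Bool.and_eq_true, decide_eq_true_eq] at this
    obtain ⟨⟨⟨⟨⟨⟨⟨⟨-, h1⟩, h2⟩, h3⟩, h4⟩, h5⟩, h6⟩, h7⟩, h8⟩ := this.2
    rw [hexShadow_sh]
    exact mem_blkR_of_digits hz hv ht1 hs1 ⟨h1, h2, h3, h4, h5, h6, h7, h8⟩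
  · rw [hexShadow_sh] at h1 hD
    obtain ⟨i, hv, rfl⟩ := exists_idx hz hk x (by rw [mem_hexBall] at h1; exact h1.trans (by norm_num))
    obtain ⟨h1, h2, h3, h4, h5, h6, h7, h8⟩ := digits_of_mem_hexBall_one hz hv h1 hD
    have hf : C.forcedB t1 s1 i = true := by
      simp only [Ctx4.forcedB, hv, Bool.true_and, Bool.and_eq_true, decide_eq_true_eq]
      refine ⟨⟨⟨⟨⟨⟨⟨h1, h2⟩, h3⟩, h4⟩, h5⟩, h6⟩, ?_⟩, ?_⟩
      · rcases ht1' with rfl | h; exact h7; omega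
      · rcases hs1' with rfl | h; exact h8; omega
    exact (vtx_mem_Wset_iff hz hv).2 (testBit_of_sdiff_beq hWfor (testBit_maskBelow_of ((validB_iff C i).1 hv).1 hf))
  · obtain ⟨e1, e2, w, hv1, hv2, hvw, rfl, rfl, rfl, -, -, -, he1, he2, hne, hneed⟩ := terminals_sound hz hk htR hsR hwT hwS hT
    obtain ⟨c1, y, b, c2, av, hcov⟩ := hcase e1 he1 e2 he2 (Ne.symm hne) w hneed
    exact coverOf_sound hz htR hsR hWv hcov

end Slab111.SK4

end Summit.CriticalPhenomena.PercolationContinuityZ3.Theorems.Transplant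

end
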